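import Literature.AlgebraicGeometry.Motives.AbelianVariety
import Literature.AlgebraicGeometry.Motives.ChowCorrespondences
import Literature.AlgebraicGeometry.Motives.BettiRealization
import Literature.AlgebraicGeometry.Motives.GoodReduction
import Literature.AlgebraicGeometry.AbelianSchemes.AbelianSchemeDualPair
import Literature.NumberTheory.Automorphic.AdicCompletionLocalField
import Literature.NumberTheory.GaloisRepresentations.WeilDelignePure
import Mathlib.Algebra.Category.ModuleCat.Basic
import Mathlib.Analysis.Complex.Basic
import Mathlib.NumberTheory.NumberField.Basic
import Mathlib.LinearAlgebra.Quotient.Basic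
import Mathlib.RingTheory.TensorProduct.Basic
import HarnessLib

/-!
# Liu 2021, §3 «Algebraic cycles and height pairings» (print pp. 33–40, items 3.1–3.13) — SECTION CARPET
# (statement-exact typing over in-file hypothesis structures; no proof) — ED.2

[Liu2021] = Yifeng Liu, *Fourier–Jacobi cycles and arithmetic relative trace formula* (with an appendix by Chao Li and
Yihang Zhu), Cambridge J. Math. **9** (2021), no. 1, 1–147 = arXiv:2102.11518.  SOURCE READ: the print text held as
`paper:liu2021-fourier-jacobi-cycles-arithmetic-relative-trace-formula` (page file `pNNNN` = journal page `N`; «p. N Lk» = line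
`k` of that page).  §3 opens p. 33 L64; §3.1 «Cycles and correspondences» p. 34; §3.2 «Beilinson–Bloch–Poincaré height
pairing» p. 35 L83 – p. 39 L18; §3.3 «Künneth–Chow projectors» p. 39 L19 – p. 40 L21.  Standing sentence (p. 33 L72): «Let `k`
be a field of characteristic zero. We work in the category `Sch_{/k}`.»  Dedup (2026-09-02): no other tree declaration cites any
item 3.1–3.13 of [Liu2021]; squad TL «GO 500», deal sheet `SPLIT-TL.v1`, second block of TL-t02.

**ED.2 (2026-09-02, TL-plan ruling 02:37:00Z MUST (3) on T-ref2's (c) STRENGTH PASS; statements otherwise unchanged, all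
declaration names of ED.1 kept except the dropped carrier law `quot_surjective`, now the tree theorem `ChowGroup.mk_surjective`).**
P1 — the Chow / cycle / Betti CARRIERS of ED.1 are RETYPED on the tree's REAL objects: `Z^i(X)`, `CH^i(X)`, `CH^i(X)_ℚ` are the
tree's dimension-graded `Motives.cyclesOfDim X e`, `Motives.ChowGroup X e`, `Motives.RatChowGroup X e = ℚ ⊗_ℤ CH_e(X)` with the
directory's explicit-degree idiom `i + e = d` (codimension `i` = dimension `d − i` on the pure-`d`-dimensional smooth `X`:
[Hartshorne1977, II Ex. 3.20], the tree's named fact `Motives.cyclesOfCodim_eq_cyclesOfDim`, discharged for smooth projective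
varieties), the surjection `Z^i(X) → CH^i(X)` is `ChowGroup.mk`; `H^j_{B,τ}(X, ℚ)` is the tree's `Motives.bettiCohomology` for the
algebra structure `τ : k →+* ℂ` (`bettiH`; this forces universe `0`, as in the sibling ED.2 of `Sec41MotivesCMCharacters`);
in §3.3 `CH^d(X × X)_ℚ`, `Δ_X`, `ᵗz`, the correspondences and Chow groups of `X × X × X` are the tree's `Motives.Corr X X d`,
`ChowCorrespondences.diag`, `ChowCorrespondences.transpose` (over a datum `C : ChowCorrespondences k`, the tree's convention),
`Corr (X ⊗ X ⊗ X) (X ⊗ X ⊗ X) (3d)`, `RatChowGroup`; `π₀(X)` is Mathlib's `ConnectedComponents`; the Mordell–Weil groups `A(k)`,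
`A^∨(k)` are `Additive (A.Points k)`; the dual abelian variety / dual abelian scheme and the Poincaré bundle of Def. 3.7 / Rem. 3.9
are pinned to the tree's `AbelianSchemes.AbelianSchemeOver.DualPair` (`hat`, `P`).  What STAYS a carrier, now a MAP between real
objects: the de Rham, `ℓ`-adic and Betti cycle class maps, `AJ_ℓ`, the pairings, the intersection product, the Fourier–Mukai
transforms, `z^*`, `cl^*_{dR}` — Mathlib / the tree have no algebraic de Rham or `ℓ`-adic cohomology of a general `k`-scheme and no
intersection product on Chow groups; the tree's Betti cycle class `WeilCohomology.chowGroupCycleMap` of a `BettiHodgeData` is stated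
for `IsSmoothProjective` (geometrically irreducible) `X`, which Liu's pure-dimensional, possibly disconnected `X` (his `π₀(X)`,
p. 39 L46) is not — recorded, not pinned.  Indices out of the printed range (e.g. `CH^{d+1}(X) = 0`) have no instance of the
degree equations: those vacuous printed cases are not carried.
P2 — `IsDefined`, `WeightMonodromy` (§3.2) and `WeightMonodromyX` (Rem. 3.8) are no longer bare propositions but REAL
definitions with the printed content of p. 36 L9–19 / Rem. 3.4 / Rem. 3.8: nonarchimedean places are `HeightOneSpectrum (𝓞 k)`,
«`X_v` has good reduction» is the tree's `Motives.HasGoodReductionAt X d v`, the printed per-place choice «a rational prime `ℓ` not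
underlying `v`» is REAL data, and «`H^j_ét(X_{k_v^ac}, ℚ_ℓ)` satisfies the weight-monodromy conjecture» is `WeilDeligneRep.IsPure`
(pure of weight `j`, [TaylorYoshida2007, §1, p. 471], the tree's `WeilDelignePure`) of a ⟨CARRIER⟩ Weil–Deligne representation of
`W_{k_v}` over `ℂ` on the completion `v.adicCompletion k` (tree instance `instIsNonarchimedeanLocalFieldAdicCompletion`) standing for
the one attached to that cohomology group through `ι : ℂ ≃ ℚ_ℓ^{ac}` (p. 36 L13–17).

## Discipline (as in `Thm418AsPrinted`, «What a CARRIER is», and the squad ruling «in-file hypothesis structures»)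

Each subsection gets ONE hypothesis structure whose REAL fields are the scheme `X : SchemeOver k` with its printed attributes
(Mathlib `SmoothOfRelativeDimension`, `IsProper`, tree `IsProjectiveOver` — NOT the tree's `IsSmoothProjective`, which adds
geometric irreducibility), the tree objects listed under ED.2 above and, in §3.2, the abelian varieties (tree
`Motives.AbelianVariety k`); every other object the text NAMES is a ⟨CARRIER⟩ field, its printed definition quoted; ⟨CARRIER LAW⟩
marks a printed property of a carrier that a later printed sentence uses.  Everything DEFINED by the text from those objects is a
REAL `def` (Def. 3.1, 3.3, (3.2), 3.7, 3.9, the cycles `z_{X,D}` of Lem. 3.11, the triple cycle of Lem. 3.12, Def. 3.13); every CLAIM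
is a predicate `def … : Prop` on the datum.  NOTHING IS ASSERTED; a consumer takes `(h : Lem35 D)` for ITS OWN datum; `∀ D, …` is
never claimed.  Cohomology groups other than Betti are recorded as `ℚ`-vector spaces (READING V1: no sentence of §3 uses the `k`- or
`ℚ_ℓ`-linear structure).  «Intermediate ring `ℚ ⊆ R ⊆ ℂ`» = `R : Subalgebra ℚ ℂ` (READING V2); `M_R := R ⊗_ℚ M`.  Universe `0`
throughout (ED.2, forced by `bettiCohomology` and `HasGoodReductionAt`).

## INDEX (item ↦ declaration of this file; namespace `Literature.NumberTheory.Automorphic.Liu2021.Sec3CyclesHeightPairings`)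

§3.1 (p. 34–35) over `Sec31Data k`: `Z^i(X)`, `CH^i(X)`, `Z^i → CH^i`, `CH^i(X)_ℚ` ↦ REAL `Sec31Data.Zc`, `CHZ`, `quot`, `CHQ`
(tree Chow groups); `H_{B,τ}` ↦ REAL `bettiH`; cycle class maps / Abel–Jacobi = carrier maps; «`CH^i(X)^0_ℚ` coincides with the
kernel of the Betti … and the `ℓ`-adic cycle class map» (p. 34 L12–18) ↦ `KernelsCoincide`; **Def. 3.1** ↦ `CH0`, `CH1`, `CH0R`,
`CHnat` (REAL); **Rem. 3.2** (Beilinson's expectation `ker AJ_ℓ = {0}`) ↦ NO declaration (an unproven expectation is not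
Literature; its content here is `CH1 D h = ⊥`); **Def. 3.3** ↦ `IsChowConvergent`, `IsChowSum` (REAL).
§3.2 (p. 35–39) over `BBHeightPairingData k` (+ `AbelianNTData`, `BBPHeightPairingData`, `RelBBPData`): the
Beilinson–Bloch pairing (3.1) = carrier `bb`/`bbR`; the conditionality of p. 36 L9–19 ↦ REAL `SatisfiesWMC`, `IsDefined`; **Rem. 3.4**
↦ REAL `WeightMonodromy`, predicate `Rem34`; **Lem. 3.5** ↦ `Lem35`; Néron–Tate (3.2) ↦ `AbelianNTData.ntChow`; **Rem. 3.6** ↦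
`Rem36`; **Def. 3.7** ↦ `BBPHeightPairingData.bbp`; **Rem. 3.8** ↦ REAL `WeightMonodromyX`, predicate `Rem38`; **Rem. 3.9** ↦
`RelBBPData.bbpRel` (over the tree's `AbelianSchemeOver` + `DualPair`).  §3.3 (p. 39–40) over `KunnethChowData k`: **Def. 3.10** ↦
`IsEvenProjector`, `IsOddProjector`, `IsKunnethChowProjector`; **Lem. 3.11** ↦ `zCurve`, `Lem311_1`, `zSurface`, `Lem311_2` (Def. 2.8
«almost ample», Prop. 2.12 `e_{X,D}` = carriers; typed for divisors in the squad file `Sec2AlbaneseVariety.lean`); **Lem. 3.12** ↦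
`Lem312_1`, `oddTriple`, `Lem312_2`; **Def. 3.13** ↦ `pr3`, `Def313Range`.
NOT typed: the local indices `⟨Z₁, Z₂⟩_{X_v}` and formula (3.1) (carried whole), Beilinson's expected independence of `ℓ, ι`
(p. 36 L41), Rem. 3.2, the curve / abelian-variety comparisons of Rem. 3.4, the two reductions of Rem. 3.8, the vector-space structure of
`CZ^i(X)`, proofs.

## References
* [Liu2021] §3, pp. 33–40 (Def. 3.1, Rem. 3.2 p. 34; Def. 3.3 p. 35; (3.1), Rem. 3.4 p. 36; Lem. 3.5, (3.2) p. 37; Rem. 3.6,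
  Def. 3.7, Rem. 3.8 p. 38; Rem. 3.9, Def. 3.10, Lem. 3.11 p. 39; Lem. 3.12, Def. 3.13 p. 40); Def. 2.8, Prop. 2.12 (§2).
* [Hartshorne1977] II Ex. 3.20 (codimension versus dimension); [Fulton1998] §1.3, §16.1 (Chow groups, correspondences);
  [TaylorYoshida2007] §1, p. 471 (pure Weil–Deligne representations); [SerreTate1968] §1 (good reduction); [Beilinson1987],
  [Bloch1984], [Kunnemann2001] — the sources §3.2 names (not used here).
-/

noncomputable section

open CategoryTheory MonoidalCategory
open scoped TensorProduct NumberField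
open Literature.AlgebraicGeometry.Motives (SchemeOver IsProjectiveOver AbelianVariety ChowGroup RatChowGroup cyclesOfDim Corr
  ChowCorrespondences bettiCohomology HasGoodReductionAt)
open Literature.AlgebraicGeometry.AbelianSchemes (AbelianSchemeOver)
open Literature.NumberTheory.GaloisRepresentations (WeilDeligneRep WeilGroup)
open IsDedekindDomain (HeightOneSpectrum)

namespace Literature.NumberTheory.Automorphic.Liu2021.Sec3CyclesHeightPairings

/-! ## §3.1 Cycles and correspondences (p. 34–35; `k` of characteristic zero) -/

/-- `H^j_{B,τ}(X, ℚ)`, the Betti cohomology of `X` for an embedding `τ : k ↪ ℂ` (p. 34 L12–14) — REAL (ED.2): the tree's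
`Motives.bettiCohomology X j = H^j(X(ℂ); ℚ)` for the algebra structure `τ.toAlgebra` on `ℂ`. [cite: Liu2021, §3.1 (p. 34)] -/
abbrev bettiH {k : Type} [Field k] (τ : k →+* ℂ) (X : SchemeOver k) (j : ℕ) : ModuleCat.{0} ℚ :=
  letI : Algebra k ℂ := τ.toAlgebra
  bettiCohomology X j

/-- **Data of [Liu2021, §3.1]** (p. 34 L3–29): «Consider a proper smooth scheme `X ∈ Sch_{/k}` of pure dimension `d`. Let `Z^i(X)`
(resp. `CH^i(X)`) be the abelian group of algebraic cycles (resp. Chow cycles) on `X` of codimension `i`, with a natural surjective map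
`Z^i(X) → CH^i(X)`. […] We have the de Rham cycle class map `cl_{dR} : CH^i(X)_ℚ → H^{2i}_{dR}(X/k)`, whose kernel we denote by
`CH^i(X)^0_ℚ`. […] the Betti cycle class map `cl_{B,τ} : CH^i(X)_ℚ → H^{2i}_{B,τ}(X, ℚ)` for every embedding `τ : k ↪ ℂ`, and the
`ℓ`-adic cycle class map `cl_ℓ : CH^i(X)_ℚ → H^{2i}_{ét}(X_{k^{ac}}, ℚ_ℓ(i))` for every rational prime `ℓ`. Moreover, by the
Hochschild–Serre spectral sequence, we obtain the `ℓ`-adic Abel–Jacobi map `AJ_ℓ : CH^i(X)^0_ℚ → H¹(k, H^{2i−1}_{ét}(X_{k^{ac}},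
ℚ_ℓ(i)))`.»  REAL: `X`, its two attributes, and (ED.2) the cycle and Chow groups — the tree's dimension-graded `cyclesOfDim X e`,
`ChowGroup X e`, `RatChowGroup X e`, a codimension `i` being carried as a dimension `e` with `i + e = d` — and Betti cohomology
(`bettiH`).  ⟨CARRIER⟩: de Rham and `ℓ`-adic cohomology, the three cycle class maps and `AJ_ℓ` (READING V1: as `ℚ`-spaces /
`ℚ`-linear maps).  Nothing asserted. [cite: Liu2021, §3.1 (p. 34)] -/
structure Sec31Data (k : Type) [Field k] [CharZero k] where
  /-- «of pure dimension `d`». -/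
  d : ℕ
  /-- «a proper smooth scheme `X ∈ Sch_{/k}`» — REAL, Mathlib's `Over (Spec k)`. -/
  X : SchemeOver k
  /-- «smooth … of pure dimension `d`»: the structure morphism is smooth of relative dimension `d` (Mathlib). -/
  smooth : _root_.AlgebraicGeometry.SmoothOfRelativeDimension d X.hom
  /-- «proper» (Mathlib). -/
  proper : _root_.AlgebraicGeometry.IsProper X.hom
  /-- ⟨CARRIER⟩ `H^j_{dR}(X/k)` (as a `ℚ`-space, READING V1). -/
  HdR : ℕ → ModuleCat.{0} ℚ
  /-- ⟨CARRIER⟩ «the de Rham cycle class map `cl_{dR} : CH^i(X)_ℚ → H^{2i}_{dR}(X/k)`», on the REAL `CH^i(X)_ℚ = CH_e(X)_ℚ`, `i + e = d`. -/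
  cldR : ∀ ⦃i e : ℕ⦄, i + e = d → (RatChowGroup X.left e →ₗ[ℚ] HdR (2 * i))
  /-- ⟨CARRIER⟩ «the Betti cycle class map `cl_{B,τ} : CH^i(X)_ℚ → H^{2i}_{B,τ}(X, ℚ)` for every embedding `τ : k ↪ ℂ`», between the REAL
  `CH_e(X)_ℚ` and the REAL `H^{2i}(X(ℂ)_τ; ℚ)` (ED.2). -/
  clB : ∀ (τ : k →+* ℂ) ⦃i e : ℕ⦄, i + e = d → (RatChowGroup X.left e →ₗ[ℚ] bettiH τ X (2 * i))
  /-- ⟨CARRIER⟩ `H^{2i}_{ét}(X_{k^{ac}}, ℚ_ℓ(i))` for a rational prime `ℓ` (first index; second index `i`; values at non-primes unused),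
  as a `ℚ`-space. -/
  Het : ℕ → ℕ → ModuleCat.{0} ℚ
  /-- ⟨CARRIER⟩ «the `ℓ`-adic cycle class map `cl_ℓ : CH^i(X)_ℚ → H^{2i}_{ét}(X_{k^{ac}}, ℚ_ℓ(i))` for every rational prime `ℓ`». -/
  clEt : ∀ (ℓ : ℕ) ⦃i e : ℕ⦄, i + e = d → (RatChowGroup X.left e →ₗ[ℚ] Het ℓ i)
  /-- ⟨CARRIER⟩ the Galois cohomology `H¹(k, H^{2i−1}_{ét}(X_{k^{ac}}, ℚ_ℓ(i)))` (for `i = 0`: of the zero module), as a `ℚ`-space. -/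
  H1Gal : ℕ → ℕ → ModuleCat.{0} ℚ
  /-- ⟨CARRIER⟩ «the `ℓ`-adic Abel–Jacobi map `AJ_ℓ : CH^i(X)^0_ℚ → H¹(k, H^{2i−1}_{ét}(X_{k^{ac}}, ℚ_ℓ(i)))`» on `CH^i(X)^0_ℚ = ker cl_{dR}`. -/
  AJ : ∀ (ℓ : ℕ) ⦃i e : ℕ⦄ (h : i + e = d), LinearMap.ker (cldR h) →ₗ[ℚ] H1Gal ℓ i

namespace Sec31Data

variable {k : Type} [Field k] [CharZero k] (D : Sec31Data k)

/-- `Z^i(X)`, «the abelian group of algebraic cycles … on `X` of codimension `i`» (p. 34 L4) — REAL (ED.2): the tree's group `Z_e(X)` of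
`e`-dimensional cycles, `i + e = d` (on the smooth pure-`d`-dimensional `X` codimension `i` is dimension `d − i`: [Hartshorne1977, II Ex.
3.20]; tree fact `Motives.cyclesOfCodim_eq_cyclesOfDim`). [cite: Liu2021, §3.1 (p. 34)] -/
abbrev Zc (e : ℕ) := cyclesOfDim D.X.left e

/-- `CH^i(X)`, «the abelian group of … Chow cycles on `X` of codimension `i`» (p. 34 L4–5) — REAL (ED.2): the tree's `CH_e(X)`
([Fulton1998] §1.3), `i + e = d`. [cite: Liu2021, §3.1 (p. 34)] -/
abbrev CHZ (e : ℕ) : Type := ChowGroup D.X.left e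

/-- «a natural surjective map `Z^i(X) → CH^i(X)`» (p. 34 L5) — REAL (ED.2): the tree's quotient map `ChowGroup.mk` (surjective:
`ChowGroup.mk_surjective`, which replaces the ED.1 carrier law `quot_surjective`). [cite: Liu2021, §3.1 (p. 34)] -/
abbrev quot (e : ℕ) : ↥(D.Zc e) →+ D.CHZ e := ChowGroup.mk D.X.left e

/-- `CH^i(X)_ℚ := CH^i(X) ⊗ ℚ` (p. 34 L9) — REAL: the tree's `RatChowGroup X e = ℚ ⊗_ℤ CH_e(X)`, `i + e = d`. [cite: Liu2021, §3.1 (p. 34)] -/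
abbrev CHQ (e : ℕ) : Type := RatChowGroup D.X.left e

/-- `H^j_{B,τ}(X, ℚ)` for an embedding `τ : k ↪ ℂ` (p. 34 L12–14) — REAL (ED.2; in ED.1 a carrier field of this name): `bettiH τ X j`, the
tree's Betti cohomology of `X(ℂ)_τ`. [cite: Liu2021, §3.1 (p. 34)] -/
abbrev HB (τ : k →+* ℂ) (j : ℕ) : ModuleCat.{0} ℚ := bettiH τ D.X j

/-- `CH^i(X)^0_ℚ := ker cl_{dR}` (p. 34 L10: «whose kernel we denote by `CH^i(X)^0_ℚ`»), a subspace of the REAL `CH_e(X)_ℚ`, `i + e = d`.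
REAL from the carrier `cl_{dR}`. [cite: Liu2021, §3.1 (p. 34)] -/
abbrev CH0 {i e : ℕ} (h : i + e = D.d) : Submodule ℚ (D.CHQ e) := LinearMap.ker (D.cldR h)

/-- **[Liu2021, §3.1, p. 34 L10–18] AS PRINTED**: «By various comparison theorems, `CH^i(X)^0_ℚ` coincides with the kernel of the Betti
cycle class map `cl_{B,τ}` … for every embedding `τ : k ↪ ℂ`, and the `ℓ`-adic cycle class map `cl_ℓ` … for every rational prime `ℓ`.»
Predicate on the datum (every codimension `i`, carried as `i + e = d`); NO PROOF. [cite: Liu2021, §3.1 (p. 34 L10–18)] -/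
def KernelsCoincide : Prop :=
  (∀ (τ : k →+* ℂ) ⦃i e : ℕ⦄ (h : i + e = D.d), LinearMap.ker (D.clB τ h) = D.CH0 h) ∧
    ∀ ℓ : ℕ, ℓ.Prime → ∀ ⦃i e : ℕ⦄ (h : i + e = D.d), LinearMap.ker (D.clEt ℓ h) = D.CH0 h

/-- **[Liu2021, Definition 3.1], first clause** (p. 34 L29–31): «We put `CH^i(X)^1_ℚ := ⋂_ℓ ker AJ_ℓ` as a subspace of `CH^i(X)^0_ℚ`, where
the intersection is taken over all rational primes `ℓ`». REAL. [cite: Liu2021, Def. 3.1 (p. 34)] -/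
def CH1 {i e : ℕ} (h : i + e = D.d) : Submodule ℚ (D.CH0 h) :=
  ⨅ (ℓ : ℕ) (_ : ℓ.Prime), LinearMap.ker (D.AJ ℓ h)

/-- **[Liu2021, Definition 3.1]**: «`CH^i(X)^0_R := CH^i(X)^0_ℚ ⊗_ℚ R` … for every ring `R` containing `ℚ`» (a `ℚ`-algebra `R`; written
`R ⊗_ℚ –`, Mathlib's side for the `R`-module structure). REAL. [cite: Liu2021, Def. 3.1 (p. 34)] -/
abbrev CH0R (R : Type) [CommRing R] [Algebra ℚ R] {i e : ℕ} (h : i + e = D.d) : Type := R ⊗[ℚ] D.CH0 h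

/-- **[Liu2021, Definition 3.1]**: «`CH^i(X)^♮_R := (CH^i(X)^0_ℚ / CH^i(X)^1_ℚ) ⊗_ℚ R` for every ring `R` containing `ℚ`. We call elements in
`CH^i(X)^♮_R` natural cycles (of codimension `i`).» REAL. [cite: Liu2021, Def. 3.1 (p. 34)] -/
abbrev CHnat (R : Type) [CommRing R] [Algebra ℚ R] {i e : ℕ} (h : i + e = D.d) : Type := R ⊗[ℚ] (D.CH0 h ⧸ D.CH1 h)

/-- `CH^i(X)_ℂ` (Def. 3.3: «the image of `{Z_j}_j` in `CH^i(X)_ℂ`»), `i + e = d`. REAL. [cite: Liu2021, Def. 3.3 (p. 35)] -/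
abbrev CHC (e : ℕ) : Type := ℂ ⊗[ℚ] D.CHQ e

/-- The class in `CH^i(X)_ℂ` of a cycle `Z ∈ Z^i(X)` (`= Z_e(X)`, `i + e = d`): `1 ⊗ (1 ⊗ [Z])` through the tree's `ChowGroup.mk` and
`ChowGroup.toRat`. REAL. [cite: Liu2021, Def. 3.3 (p. 35)] -/
def classC (e : ℕ) (Z : ↥(D.Zc e)) : D.CHC e := (1 : ℂ) ⊗ₜ[ℚ] ChowGroup.toRat _ e (D.quot e Z)

/-- **[Liu2021, Definition 3.3] AS PRINTED** (p. 35 L6–10): «We say that a formal series `∑_j c_j Z_j` with `c_j ∈ ℂ` and `Z_j ∈ Z^i(X)` is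
*Chow convergent* if the image of `{Z_j}_j` in `CH^i(X)_ℂ` generates a finite dimensional subspace, and the induced formal series in this
finite dimensional space is absolutely convergent.»  A formal series = a sequence `s : ℕ → ℂ × Z^i(X)` of terms `(c_j, Z_j)` (`Z^i = Z_e`,
`i + e = d`).  READING S1 («absolutely convergent» in a finite-dimensional complex space): for every linear functional `f` the scalar series
`∑_j c_j f([Z_j])` converges absolutely (equivalent to norm-absolute convergence for any norm on the finite-dimensional span). REAL.
[cite: Liu2021, Def. 3.3 (p. 35)] -/
def IsChowConvergent (e : ℕ) (s : ℕ → ℂ × ↥(D.Zc e)) : Prop :=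
  FiniteDimensional ℂ (Submodule.span ℂ (Set.range fun j => D.classC e (s j).2)) ∧
    ∀ f : D.CHC e →ₗ[ℂ] ℂ, Summable fun j => ‖(s j).1 * f (D.classC e (s j).2)‖

/-- **[Liu2021, Definition 3.3], the natural map `CZ^i(X) → CH^i(X)_ℂ`** (p. 35 L10–12: «We denote by `CZ^i(X)` the set of Chow convergent
formal series in `Z^i(X)`, which … admits a natural complex linear map `CZ^i(X) → CH^i(X)_ℂ`»): `v` is the sum of the Chow convergent series
`s` — for every linear functional `f`, `f v = ∑_j c_j f([Z_j])` (READING S1; such `v` is unique).  The vector-space structure of `CZ^i(X)`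
is not typed. REAL. [cite: Liu2021, Def. 3.3 (p. 35)] -/
def IsChowSum (e : ℕ) (s : ℕ → ℂ × ↥(D.Zc e)) (v : D.CHC e) : Prop :=
  D.IsChowConvergent e s ∧ ∀ f : D.CHC e →ₗ[ℂ] ℂ, HasSum (fun j => (s j).1 * f (D.classC e (s j).2)) (f v)

end Sec31Data

/-! ## §3.2 Beilinson–Bloch–Poincaré height pairing (p. 35 L83 – p. 39 L18; `k` a number field) -/

/-- **Data of [Liu2021, §3.2, p. 35 L84 – p. 36 L45]**: «Now suppose that `k` is a number field. Consider a projective smooth scheme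
`X ∈ Sch_{/k}` of pure dimension `d`. Beilinson [Beĭ87] and Bloch [Blo84] have defined … a bilinear pairing `⟨ , ⟩^{BB}_X : CH^i(X)^0_ℚ ×
CH^{d+1−i}(X)^0_ℚ → ℂ`» — (3.1): «`⟨Z₁, Z₂⟩^{BB}_X := ∑_v r(v) · ⟨Z₁, Z₂⟩_{X_v}`» — «For every intermediate ring `ℚ ⊆ R ⊆ ℂ`, we obtain a
pairing `⟨ , ⟩^{BB}_X : CH^i(X)^0_R × CH^{d+1−i}(X)^0_R → ℂ` via `R`-bilinear extension.»  The CONDITIONALITY (p. 36 L9–19): «For `v`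
archimedean, [the local index] is unconditional. For `v` nonarchimedean such that `X_v` has good reduction, this is defined via intersection
theory on an arbitrary smooth model of `X_v` over `O_{k_v}`. For `v` nonarchimedean in general, the definition of `⟨Z₁, Z₂⟩_{X_v}` is
conditional: Choose a rational prime `ℓ` not underlying `v` and an isomorphism `ι : ℂ ≃ ℚ_ℓ^{ac}` such that `H^{2i}_{ét}(X_{k_v^{ac}}, ℚ_ℓ)`
satisfies the weight-monodromy conjecture, which implies that the cycle class of `Z₁` in the absolute étale cohomology `H^{2i}_{ét}(X_v,
ℚ_ℓ(i))` vanishes (same for `Z₂`).»  Extends `Sec31Data` by: `projective` (REAL, tree `IsProjectiveOver`); ⟨CARRIER⟩ the pairing at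
`ℚ`-level (`bb`, for the choices `ℓ, ι` of (3.1)) and at `R`-level (`bbR`, READING V2) with ⟨CARRIER LAW⟩ `bbR_tmul` («via `R`-bilinear
extension»), indices `(i, j)` with `i + j = d + 1` for `d + 1 − i`, each codimension carried as a dimension (`i + e = d`, `j + e' = d`);
(ED.2, P2) the printed per-place choice `ell v` of «a rational prime `ℓ` not underlying `v`» — REAL data over the tree's finite places
`HeightOneSpectrum (𝓞 k)` — and, for each finite place `v`, prime `ℓ` and degree `j`, a ⟨CARRIER⟩ Weil–Deligne representation `WD v ℓ j`
of `W_{k_v}` over `ℂ` (tree `WeilDeligneRep` on `v.adicCompletion k`) standing for the one attached to `H^j_{ét}(X_{k_v^{ac}}, ℚ_ℓ)` through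
`ι` (Grothendieck's monodromy theorem; [TaylorYoshida2007, §1]), with a REAL geometric Frobenius lift `frob v` (`deg = −1`, the convention
of the tree's `WeilDeligneRep.IsPure`) — on which «satisfies the weight-monodromy conjecture» is the REAL predicate `SatisfiesWMC`;
⟨CARRIER⟩ `interR` = the intersection product `Z.Z₂` on homologically trivial classes at `R`-level (Lem. 3.5).  Nothing asserted.
[cite: Liu2021, §3.2 (pp. 35–36), (3.1)] -/
structure BBHeightPairingData (k : Type) [Field k] [NumberField k] extends Sec31Data k where
  /-- «projective» (tree `Motives.IsProjectiveOver`). -/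
  projective : IsProjectiveOver X
  /-- ⟨CARRIER⟩ `⟨ , ⟩^{BB}_X : CH^i(X)^0_ℚ × CH^j(X)^0_ℚ → ℂ`, `i + j = d + 1` (formula (3.1), p. 36 L22–32), codimensions `i`, `j` carried as
  dimensions `e`, `e'`. -/
  bb : ∀ ⦃i e j e' : ℕ⦄ (hi : i + e = d) (hj : j + e' = d), i + j = d + 1 →
    (LinearMap.ker (cldR hi) →ₗ[ℚ] LinearMap.ker (cldR hj) →ₗ[ℚ] ℂ)
  /-- ⟨CARRIER⟩ the `R`-bilinear extension `CH^i(X)^0_R × CH^j(X)^0_R → ℂ` for an intermediate ring `ℚ ⊆ R ⊆ ℂ` (p. 36 L33–40). -/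
  bbR : ∀ (R : Subalgebra ℚ ℂ) ⦃i e j e' : ℕ⦄ (hi : i + e = d) (hj : j + e' = d), i + j = d + 1 →
    ((R ⊗[ℚ] LinearMap.ker (cldR hi)) →ₗ[R] (R ⊗[ℚ] LinearMap.ker (cldR hj)) →ₗ[R] ℂ)
  /-- ⟨CARRIER LAW⟩ «via `R`-bilinear extension»: on pure tensors `bbR (r ⊗ x) (s ⊗ y) = r s ⟨x, y⟩^{BB}_X`. -/
  bbR_tmul : ∀ (R : Subalgebra ℚ ℂ) ⦃i e j e' : ℕ⦄ (hi : i + e = d) (hj : j + e' = d) (h : i + j = d + 1) (r s : R)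
    (x : LinearMap.ker (cldR hi)) (y : LinearMap.ker (cldR hj)),
    bbR R hi hj h (r ⊗ₜ x) (s ⊗ₜ y) = (r : ℂ) * (s : ℂ) * bb hi hj h x y
  /-- REAL data (ED.2): for every nonarchimedean place `v`, the printed choice «a rational prime `ℓ` not underlying `v`» (p. 36 L13). -/
  ell : HeightOneSpectrum (𝓞 k) → ℕ
  /-- «a rational prime». -/
  ell_prime : ∀ v, (ell v).Prime
  /-- «not underlying `v`»: `v ∤ ℓ`, i.e. `ℓ ∉ 𝔭_v`. -/
  ell_not_mem : ∀ v, ((ell v : ℕ) : 𝓞 k) ∉ v.asIdeal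
  /-- ⟨CARRIER⟩ the space of the Weil–Deligne representation attached to `H^j_{ét}(X_{k_v^{ac}}, ℚ_ℓ)` through `ι : ℂ ≃ ℚ_ℓ^{ac}` (indices
  `v`, `ℓ`, `j`). -/
  WDV : HeightOneSpectrum (𝓞 k) → ℕ → ℕ → ModuleCat.{0} ℂ
  /-- ⟨CARRIER⟩ «`H^j_{ét}(X_{k_v^{ac}}, ℚ_ℓ)`» as a Weil–Deligne representation of `W_{k_v}` over `ℂ` (through `ι`; Grothendieck's monodromy
  theorem), the object of which p. 36 L17 says «satisfies the weight-monodromy conjecture» — tree `WeilDeligneRep` over the completion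
  `k_v = v.adicCompletion k`. -/
  WD : ∀ (v : HeightOneSpectrum (𝓞 k)) (ℓ j : ℕ), WeilDeligneRep (v.adicCompletion k) ℂ (WDV v ℓ j)
  /-- REAL: a lift of the geometric Frobenius in `W_{k_v}` (the `φ` of the tree's `WeilDeligneRep.IsPure`). -/
  frob : ∀ v : HeightOneSpectrum (𝓞 k), WeilGroup (v.adicCompletion k)
  /-- `frob v` is a GEOMETRIC Frobenius lift: `deg = −1` (sign convention of the tree's `WeilGroup.deg`). -/
  deg_frob : ∀ v, WeilGroup.deg (frob v) = -1
  /-- ⟨CARRIER⟩ the intersection product `(Z, Z₂) ↦ Z.Z₂`, `CH^a(X)^0_R × CH^b(X)^0_R → CH^c(X)^0_R`, `a + b = c` (Lem. 3.5, p. 37 L7–9; `CH^*(X)^0`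
  is an ideal since cycle class maps are multiplicative), codimensions carried as dimensions. -/
  interR : ∀ (R : Subalgebra ℚ ℂ) ⦃a ea b eb c ec : ℕ⦄ (ha : a + ea = d) (hb : b + eb = d) (hc : c + ec = d), a + b = c →
    ((R ⊗[ℚ] LinearMap.ker (cldR ha)) →ₗ[R] (R ⊗[ℚ] LinearMap.ker (cldR hb)) →ₗ[R] (R ⊗[ℚ] LinearMap.ker (cldR hc)))

namespace BBHeightPairingData

variable {k : Type} [Field k] [NumberField k] (D : BBHeightPairingData k)

/-- **Weight–monodromy purity of `H^j_{ét}(X_{k_v^{ac}}, ℚ_ℓ)`** — the printed hypothesis of p. 36 L13–17 and of Rem. 3.4 on that cohomology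
group (the clause is quoted verbatim in the docstring of `BBHeightPairingData` and in the module docstring, P2), as a REAL predicate (ED.2) on
the carrier `WD v ℓ j`: that Weil–Deligne representation is PURE OF WEIGHT `j` in the sense of [TaylorYoshida2007, §1, p. 471] (the tree's
`WeilDeligneRep.IsPure`, with respect to the geometric Frobenius lift `frob v`) — its monodromy filtration, centred at `j`, is its weight
filtration.  A hypothesis of the printed statements, never asserted here. [cite: Liu2021, §3.2 (p. 36 L13–17)] -/
def SatisfiesWMC (v : HeightOneSpectrum (𝓞 k)) (ℓ j : ℕ) : Prop :=
  (D.WD v ℓ j).IsPure (D.frob v) (j : ℝ)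

/-- **[Liu2021, Remark 3.4], the hypothesis** «`X_v` satisfies the weight-monodromy conjecture for every nonarchimedean place `v` of `k`»
(p. 36 L47–48) — REAL (ED.2): for every finite place `v`, every rational prime `ℓ` not underlying `v` and every degree `j`,
`H^j_{ét}(X_{k_v^{ac}}, ℚ_ℓ)` satisfies it (`SatisfiesWMC`). [cite: Liu2021, Rem. 3.4 (p. 36)] -/
def WeightMonodromy : Prop :=
  ∀ (v : HeightOneSpectrum (𝓞 k)) (ℓ j : ℕ), ℓ.Prime → ((ℓ : ℕ) : 𝓞 k) ∉ v.asIdeal → D.SatisfiesWMC v ℓ j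

/-- **«the Beilinson–Bloch height pairing is defined for `X`»** (hypothesis of Lem. 3.5, p. 37 L5; content p. 36 L9–19) — REAL (ED.2):
the local indices of (3.1) are unconditional at archimedean places and at nonarchimedean places of good reduction (tree
`Motives.HasGoodReductionAt X d v`: a smooth proper model over `O_{k_v}`), and at every other nonarchimedean `v` their definition requires
that, for the chosen prime `ell v` not underlying `v`, the cohomology `H^{2i}_{ét}(X_{k_v^{ac}}, ℚ_ℓ)` satisfies the weight-monodromy
conjecture — for every codimension `i` of cycles paired (`Z₁` of codimension `i`, `Z₂` of codimension `d + 1 − i`, `0 ≤ i ≤ d + 1`).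
[cite: Liu2021, §3.2 (p. 36 L9–19) and Lem. 3.5 (p. 37)] -/
def IsDefined : Prop :=
  ∀ v : HeightOneSpectrum (𝓞 k), ¬ HasGoodReductionAt D.X D.d v → ∀ i : ℕ, i ≤ D.d + 1 → D.SatisfiesWMC v (D.ell v) (2 * i)

/-- **[Liu2021, Remark 3.4], first sentence** (p. 36 L47–52): «if `X_v` satisfies the weight-monodromy conjecture for every nonarchimedean
place `v` of `k` (for example, when `X` is a product of curves, surfaces, or abelian varieties), then the Beilinson–Bloch height pairing
`⟨ , ⟩^{BB}_X` is unconditionally defined (but may a priori depend on the choices of `ℓ` and `ι`).»  TYPED on the two REAL propositions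
`WeightMonodromy`, `IsDefined` (ED.2); the parenthetical examples are not typed.  NOT typed (p. 36 L52–56): «When `X` is a curve, [it]
coincides with the Néron–Tate height pairing up to `−1`. When `X` is an abelian variety, [it] coincides with the pairing defined in [Kün01]»
and the independence of `ℓ, ι` in these cases.  NO PROOF. [cite: Liu2021, Rem. 3.4 (p. 36)] -/
def Rem34 : Prop := D.WeightMonodromy → D.IsDefined

/-- **[Liu2021, Lemma 3.5] AS PRINTED** (p. 37 L5–9): «Suppose that the Beilinson–Bloch height pairing is defined for `X`. Take
`Z ∈ CH¹(X)^0_R` for some intermediate ring `ℚ ⊆ R ⊆ ℂ`. Then we have `⟨Z₁, Z.Z₂⟩^{BB}_X = 0` for every `Z₁ ∈ CH^i(X)^0_R` and `Z₂ ∈ CH^{d−i}(X)^0_R`.»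
(`d − i` written `j` with `i + j = d`; `Z.Z₂ ∈ CH^{1+j}(X)^0_R`, `i + (1 + j) = d + 1`; codimensions `i, j, 1, 1 + j` carried as dimensions.)
NO PROOF. [cite: Liu2021, Lem. 3.5 (p. 37)] -/
def Lem35 : Prop :=
  D.IsDefined → ∀ (R : Subalgebra ℚ ℂ) ⦃i e j e' e₁ ec : ℕ⦄ (hi : i + e = D.d) (hj : j + e' = D.d) (h1 : 1 + e₁ = D.d)
    (hc : (1 + j) + ec = D.d) (hij : i + j = D.d) (Z : R ⊗[ℚ] LinearMap.ker (D.cldR h1))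
    (Z₁ : R ⊗[ℚ] LinearMap.ker (D.cldR hi)) (Z₂ : R ⊗[ℚ] LinearMap.ker (D.cldR hj)),
    D.bbR R hi hc ((Nat.add_left_comm i 1 j).trans ((congrArg (fun t => 1 + t) hij).trans (Nat.add_comm 1 D.d)))
      Z₁ (D.interR R h1 hj hc rfl Z Z₂) = 0

end BBHeightPairingData

/-- **Data of the Néron–Tate pairing (3.2) and Remark 3.6** (p. 37 L33 – p. 38 L31): «if `A` is an abelian variety over `k` of dimension
`h ≥ 1`, and `ℚ ⊆ R ⊆ ℂ` is an intermediate ring, then we also have the Néron–Tate (bilinear) height pairing `⟨ , ⟩^{NT}_A : A(k)_R ×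
A^∨(k)_R → ℂ`. Composing with the Albanese maps `CH^h(A)^0_R → A(k)_R` and `CH^h(A^∨)^0_R → A^∨(k)_R`, we may regard the above pairing as a map
(3.2) `⟨ , ⟩^{NT}_A : CH^h(A)^0_R × CH^h(A^∨)^0_R → ℂ`.»  REAL: `A`, `Adual` (tree abelian varieties) with (ED.2) the tree's duality datum `dualPair : DualPair` of `A` and `dualIso` identifying its dual abelian scheme with `Adual`, `h = A.dim`; `B` = the §3.2 datum OF `A`
(`B.X ≅ A.X`, `B.d = h`); (ED.2) the Mordell–Weil groups `A(k)`, `A^∨(k)` = `Additive (A.Points k)` (tree), `CH^h(A)_ℚ = CH_0(B.X)_ℚ`,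
`CH^h(A^∨)_ℚ = CH_0(A^∨)_ℚ` (tree `RatChowGroup`, zero-cycles).  ⟨CARRIER⟩: `H^{2h}_{dR}(A^∨/k)` with its cycle class map `cldRAd` (whose kernel
is `CH^h(A^∨)^0_ℚ`), the Néron–Tate pairing at `R`-level, the two Albanese maps at `R`-level, and (Rem. 3.6) «the tautological map
`CH¹(A)^0_R → CH^h(A^∨)^0_R`».  Nothing asserted. [cite: Liu2021, §3.2 (3.2) and Rem. 3.6 (pp. 37–38)] -/
structure AbelianNTData (k : Type) [Field k] [NumberField k] where
  /-- «an abelian variety over `k`» — REAL (tree). -/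
  A : AbelianVariety k
  /-- its dual abelian variety `A^∨` — REAL (tree `AbelianVariety`, the currency of §4). -/
  Adual : AbelianVariety k
  /-- REAL bridge (ED.2): the duality datum of `A` — the tree's scheme-theoretic `AbelianSchemeOver.DualPair` of `A` (dual abelian scheme `hat`
  with the normalised Poincaré sheaf `P` on `A × A^∨`, fibrewise in `Pic⁰`, universal), through `AbelianSchemeOver.ofAbelianVariety`. -/
  dualPair : (AbelianSchemeOver.ofAbelianVariety A).DualPair
  /-- REAL: `Adual` IS the dual — an identification over `k` of the dual abelian scheme of `dualPair` with `Adual`. -/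
  dualIso : dualPair.hat.X ≅ Adual.X
  /-- «of dimension `h ≥ 1`», `h := A.dim`. -/
  one_le_dim : 1 ≤ A.dim
  /-- the §3.2 datum of `A` itself (its Chow groups, `⟨ , ⟩^{BB}_A`, used by Rem. 3.6). -/
  B : BBHeightPairingData k
  /-- `B` is the datum OF `A`: its scheme is `A`'s. -/
  isoX : B.X ≅ A.X
  /-- … and its pure dimension is `h`. -/
  d_eq : B.d = A.dim
  /-- ⟨CARRIER⟩ `H^{2h}_{dR}(A^∨/k)` (as a `ℚ`-space). -/
  HdRAd : ModuleCat.{0} ℚ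
  /-- ⟨CARRIER⟩ `cl_{dR} : CH^h(A^∨)_ℚ → H^{2h}_{dR}(A^∨/k)` on the REAL zero-cycles `CH_0(A^∨)_ℚ`; its kernel is `CH^h(A^∨)^0_ℚ`. -/
  cldRAd : RatChowGroup Adual.X.left 0 →ₗ[ℚ] HdRAd
  /-- ⟨CARRIER⟩ «the Néron–Tate (bilinear) height pairing `⟨ , ⟩^{NT}_A : A(k)_R × A^∨(k)_R → ℂ`», `A(k)_R = R ⊗_ℤ A(k)` on the REAL Mordell–Weil
  groups. -/
  nt : ∀ R : Subalgebra ℚ ℂ, ((R ⊗[ℤ] Additive (A.Points k)) →ₗ[R] (R ⊗[ℤ] Additive (Adual.Points k)) →ₗ[R] ℂ)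
  /-- ⟨CARRIER⟩ «the Albanese map `CH^h(A)^0_R → A(k)_R`» (`CH^h(A) = CH_0`, codimension `h = B.d`, dimension `0`). -/
  albR : ∀ R : Subalgebra ℚ ℂ,
    ((R ⊗[ℚ] LinearMap.ker (B.cldR (Nat.add_zero B.d))) →ₗ[R] (R ⊗[ℤ] Additive (A.Points k)))
  /-- ⟨CARRIER⟩ «the Albanese map `CH^h(A^∨)^0_R → A^∨(k)_R`». -/
  albDualR : ∀ R : Subalgebra ℚ ℂ, ((R ⊗[ℚ] LinearMap.ker cldRAd) →ₗ[R] (R ⊗[ℤ] Additive (Adual.Points k)))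
  /-- ⟨CARRIER⟩ «the tautological map `CH¹(A)^0_R → CH^h(A^∨)^0_R`» (Rem. 3.6, p. 38 L31), codimension `1` carried as dimension `e₁`. -/
  tautR : ∀ (R : Subalgebra ℚ ℂ) ⦃e₁ : ℕ⦄ (h1 : 1 + e₁ = B.d),
    ((R ⊗[ℚ] LinearMap.ker (B.cldR h1)) →ₗ[R] (R ⊗[ℚ] LinearMap.ker cldRAd))

namespace AbelianNTData

variable {k : Type} [Field k] [NumberField k] (N : AbelianNTData k)

/-- The Mordell–Weil group `A(k)` (p. 37 L35: «`⟨ , ⟩^{NT}_A : A(k)_R × A^∨(k)_R → ℂ`») — REAL (ED.2; in ED.1 a carrier of this name): the tree's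
`A.Points k`, written additively. [cite: Liu2021, §3.2 (3.2) (p. 37)] -/
abbrev Ak : Type := Additive (N.A.Points k)

/-- The Mordell–Weil group `A^∨(k)` of the dual — REAL (ED.2; in ED.1 a carrier of this name). [cite: Liu2021, §3.2 (3.2) (p. 37)] -/
abbrev Adualk : Type := Additive (N.Adual.Points k)

/-- `CH^h(A^∨)^0_ℚ`, the homologically trivial zero-cycles on `A^∨`: kernel of the carrier `cl_{dR}` on the REAL `CH_0(A^∨)_ℚ` (ED.2; in ED.1 a
bare carrier). [cite: Liu2021, §3.2 (3.2) (p. 37)] -/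
abbrev CH0dual : Submodule ℚ (RatChowGroup N.Adual.X.left 0) := LinearMap.ker N.cldRAd

/-- **[Liu2021, (3.2)]**: `⟨ , ⟩^{NT}_A : CH^h(A)^0_R × CH^h(A^∨)^0_R → ℂ`, the Néron–Tate pairing composed with the two Albanese maps. REAL
(from the carriers). [cite: Liu2021, §3.2 (3.2) (p. 37)] -/
def ntChow (R : Subalgebra ℚ ℂ) (z : R ⊗[ℚ] LinearMap.ker (N.B.cldR (Nat.add_zero N.B.d))) (w : R ⊗[ℚ] N.CH0dual) : ℂ :=
  N.nt R (N.albR R z) (N.albDualR R w)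

/-- **[Liu2021, Remark 3.6] AS PRINTED** (p. 38 L5–31): «The Néron–Tate height pairing (3.2) is related to the Beilinson–Bloch height pairing
via the following commutative diagram» — `CH^h(A)^0_R × CH¹(A)^0_R → ℂ` by `⟨ , ⟩^{BB}_A` on top, `CH^h(A)^0_R × CH^h(A^∨)^0_R → ℂ` by
`−⟨ , ⟩^{NT}_A` below, «in which `CH¹(A)^0_R → CH^h(A^∨)^0_R` is the tautological map.»  TYPED: for every `R`, `z ∈ CH^h(A)^0_R`, `w ∈ CH¹(A)^0_R`:
`⟨z, w⟩^{BB}_A = −⟨z, taut(w)⟩^{NT}_A` (codimensions `h = B.d` and `1`, `h + 1 = B.d + 1`).  NO PROOF. [cite: Liu2021, Rem. 3.6 (p. 38)] -/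
def Rem36 : Prop :=
  ∀ (R : Subalgebra ℚ ℂ) ⦃e₁ : ℕ⦄ (h1 : 1 + e₁ = N.B.d) (z : R ⊗[ℚ] LinearMap.ker (N.B.cldR (Nat.add_zero N.B.d)))
    (w : R ⊗[ℚ] LinearMap.ker (N.B.cldR h1)),
    N.B.bbR R (Nat.add_zero N.B.d) h1 rfl z w = -N.ntChow R z (N.tautR R h1 w)

end AbelianNTData

/-- **Data of [Liu2021, Definition 3.7]** (p. 38 L32–51): «Now we will combine the Beilinson–Bloch height pairing on `X` and the Néron–Tate
height pairing on `A` to give a height pairing `⟨ , ⟩^{BBP}_{X,A} : CH^{h+i}(X × A)^0_R × CH^{h+d−i}(X × A^∨)^0_R → ℂ` using the Poincaré bundle, for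
every intermediate ring `ℚ ⊆ R ⊆ ℂ`. […] Let `P` be the Poincaré line bundle on `A × A^∨`. We have projection morphisms `p₁₂ : X × A × A^∨ →
X × A`, `p₁₃ : X × A × A^∨ → X × A^∨`, and recall the Fourier–Mukai transform `℘ : CH^{h+d−i}(X × A^∨)^0_R → CH^{d+1−i}(X × A)^0_R` sending `z` to
`p₁₂∗((X × c₁(P)).p₁₃^* z)`.»  REAL: `X` projective smooth of pure dimension `d`; `A`, `Adual` (tree abelian varieties) with
(ED.2) the tree's duality datum `dualPair` of `A` — dual abelian scheme and Poincaré sheaf `P` — identified with `Adual` by `dualIso`, `h = A.dim ≥ 1`; `XA` = the §3.2 datum of `X × A` (`XA.X ≅ X ⊗ A.X`, `XA.d = d + h`); (ED.2) `CH^n(X × A^∨)_ℚ = CH_e(X ⊗ Adual.X)_ℚ`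
(tree `RatChowGroup`, `n + e = d + h`).  ⟨CARRIER⟩: `H_{dR}` of `X × A^∨` with its cycle class map (whose kernels are the
`CH^n(X × A^∨)^0_ℚ`), the Fourier–Mukai transform `℘` (its printed formula is the MEANING of the carrier; indices `n + 1 = m + h`), and
the Weil–Deligne representations of the cohomology of the fibres `X_v` (Rem. 3.8, as in `BBHeightPairingData`).  Nothing asserted.
[cite: Liu2021, Def. 3.7 (p. 38)] -/
structure BBPHeightPairingData (k : Type) [Field k] [NumberField k] where
  /-- «of pure dimension `d`». -/
  d : ℕ
  /-- `X` — REAL. -/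
  X : SchemeOver k
  /-- smooth of pure dimension `d` (Mathlib). -/
  smooth : _root_.AlgebraicGeometry.SmoothOfRelativeDimension d X.hom
  /-- projective (tree `IsProjectiveOver`). -/
  projective : IsProjectiveOver X
  /-- «an abelian variety over `k`» — REAL (tree). -/
  A : AbelianVariety k
  /-- its dual abelian variety `A^∨` — REAL (tree `AbelianVariety`, the currency of §4). -/
  Adual : AbelianVariety k
  /-- REAL bridge (ED.2): the duality datum of `A` — the tree's scheme-theoretic `AbelianSchemeOver.DualPair` of `A` (dual abelian scheme `hat`
  with the normalised Poincaré sheaf `P` on `A × A^∨`, fibrewise in `Pic⁰`, universal), through `AbelianSchemeOver.ofAbelianVariety`. -/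
  dualPair : (AbelianSchemeOver.ofAbelianVariety A).DualPair
  /-- REAL: `Adual` IS the dual — an identification over `k` of the dual abelian scheme of `dualPair` with `Adual`. -/
  dualIso : dualPair.hat.X ≅ Adual.X
  /-- «`h ≥ 1`», `h := A.dim`. -/
  one_le_dim : 1 ≤ A.dim
  /-- the §3.2 datum of `X × A` (its `⟨ , ⟩^{BB}_{X×A}` is used by Def. 3.7; its places / Frobenius lifts are reused by Rem. 3.8). -/
  XA : BBHeightPairingData k
  /-- `XA` is the datum OF `X × A` (cartesian product in `Sch_{/k}`). -/
  isoXA : XA.X ≅ X ⊗ A.X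
  /-- … of pure dimension `d + h`. -/
  dXA : XA.d = d + A.dim
  /-- ⟨CARRIER⟩ `H^j_{dR}((X × A^∨)/k)` (as a `ℚ`-space). -/
  HdRXAd : ℕ → ModuleCat.{0} ℚ
  /-- ⟨CARRIER⟩ `cl_{dR}` of `X × A^∨` on the REAL `CH^n(X × A^∨)_ℚ = CH_e(X ⊗ A^∨)_ℚ`, `n + e = d + h`; its kernels are the `CH^n(X × A^∨)^0_ℚ`. -/
  cldRXAd : ∀ ⦃n e : ℕ⦄, n + e = d + A.dim → (RatChowGroup (X ⊗ Adual.X).left e →ₗ[ℚ] HdRXAd (2 * n))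
  /-- ⟨CARRIER⟩ «the Fourier–Mukai transform `℘ : CH^n(X × A^∨)^0_R → CH^m(X × A)^0_R` sending `z` to `p₁₂∗((X × c₁(P)).p₁₃^* z)`» (`P` = the Poincaré
  sheaf `dualPair.P`), `n + 1 = m + h` (print: `n = h + d − i`, `m = d + 1 − i`), codimensions carried as dimensions. -/
  fm : ∀ (R : Subalgebra ℚ ℂ) ⦃n e m e' : ℕ⦄ (hn : n + e = d + A.dim) (hm : m + e' = XA.d), n + 1 = m + A.dim →
    ((R ⊗[ℚ] LinearMap.ker (cldRXAd hn)) →ₗ[R] (R ⊗[ℚ] LinearMap.ker (XA.cldR hm)))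
  /-- ⟨CARRIER⟩ the space of the Weil–Deligne representation attached to `H^j_{ét}` of the fibre `X_{k_v^{ac}}` of `X` ITSELF (Rem. 3.8), indices
  `v`, `ℓ`, `j`. -/
  WDVX : HeightOneSpectrum (𝓞 k) → ℕ → ℕ → ModuleCat.{0} ℂ
  /-- ⟨CARRIER⟩ «`H^j_{ét}(X_{k_v^{ac}}, ℚ_ℓ)`» of `X` itself as a Weil–Deligne representation of `W_{k_v}` over `ℂ` (as `BBHeightPairingData.WD`). -/
  WDX : ∀ (v : HeightOneSpectrum (𝓞 k)) (ℓ j : ℕ), WeilDeligneRep (v.adicCompletion k) ℂ (WDVX v ℓ j)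

namespace BBPHeightPairingData

variable {k : Type} [Field k] [NumberField k] (D : BBPHeightPairingData k)

/-- `CH^n(X × A^∨)^0_ℚ`: kernel of the carrier `cl_{dR}` on the REAL `CH_e(X ⊗ A^∨)_ℚ`, `n + e = d + h` (ED.2; in ED.1 a bare carrier).
[cite: Liu2021, Def. 3.7 (p. 38)] -/
abbrev CH0dual {n e : ℕ} (hn : n + e = D.d + D.A.dim) : Submodule ℚ (RatChowGroup (D.X ⊗ D.Adual.X).left e) :=
  LinearMap.ker (D.cldRXAd hn)

/-- **[Liu2021, Definition 3.7] — the Beilinson–Bloch–Poincaré height pairing for `(X, A)`** (p. 38 L48–54): «We then define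
`⟨z₁, z₂⟩^{BBP}_{X,A} := ⟨z₁, ℘(z₂)⟩^{BB}_{X×A}`. Definition 3.7. We call `⟨ , ⟩^{BBP}_{X,A}` the *Beilinson–Bloch–Poincaré height pairing* for `(X, A)`.»
REAL from the carriers `⟨ , ⟩^{BB}_{X×A}` and `℘`: for `z₁ ∈ CH^{h+i}(X × A)^0_R` and `z₂ ∈ CH^n(X × A^∨)^0_R`, with `(h + i) + m = (d + h) + 1` and
`n + 1 = m + h` (print: `m = d + 1 − i`, `n = h + d − i`), codimensions carried as dimensions. [cite: Liu2021, Def. 3.7 (p. 38)] -/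
def bbp (R : Subalgebra ℚ ℂ) ⦃i e₁ m e' n e : ℕ⦄ (hi : (D.A.dim + i) + e₁ = D.XA.d) (hm : m + e' = D.XA.d)
    (hn : n + e = D.d + D.A.dim) (him : (D.A.dim + i) + m = D.XA.d + 1) (hnm : n + 1 = m + D.A.dim)
    (z₁ : R ⊗[ℚ] LinearMap.ker (D.XA.cldR hi)) (z₂ : R ⊗[ℚ] D.CH0dual hn) : ℂ :=
  D.XA.bbR R hi hm him z₁ (D.fm R hn hm hnm z₂)

/-- **Weight–monodromy purity of `H^j_{ét}` of the fibre at `v` of `X` ITSELF**, in degree `j` and for the prime `ℓ` — the printed hypothesis of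
Rem. 3.8 on `X_v` (quoted verbatim on `WeightMonodromyX` and `Rem38`), as a REAL predicate (ED.2) on the carrier `WDX v ℓ j`: pure of weight `j`
([TaylorYoshida2007, §1, p. 471], tree `WeilDeligneRep.IsPure`) for the geometric Frobenius lift `XA.frob v`.  Never asserted here.
[cite: Liu2021, Rem. 3.8 (p. 38)] -/
def SatisfiesWMCX (v : HeightOneSpectrum (𝓞 k)) (ℓ j : ℕ) : Prop :=
  (D.WDX v ℓ j).IsPure (D.XA.frob v) (j : ℝ)

/-- **[Liu2021, Remark 3.8], the hypothesis** «`X_v` satisfies the weight-monodromy conjecture for every nonarchimedean place `v` of `k`»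
(p. 38 L55) — REAL (ED.2), as `BBHeightPairingData.WeightMonodromy` but for `X` itself. [cite: Liu2021, Rem. 3.8 (p. 38)] -/
def WeightMonodromyX : Prop :=
  ∀ (v : HeightOneSpectrum (𝓞 k)) (ℓ j : ℕ), ℓ.Prime → ((ℓ : ℕ) : 𝓞 k) ∉ v.asIdeal → D.SatisfiesWMCX v ℓ j

/-- **[Liu2021, Remark 3.8], first sentence AS PRINTED** (p. 38 L55–56): «The Beilinson–Bloch–Poincaré height pairing is unconditionally defined
if `X_v` satisfies the weight-monodromy conjecture for every nonarchimedean place `v` of `k` (but may a priori depend on the choices of `ℓ` and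
`ι`).» — typed as: `WeightMonodromyX` (REAL since ED.2) implies that `⟨ , ⟩^{BB}_{X×A}` (hence `⟨ , ⟩^{BBP}_{X,A}`, Def. 3.7) is defined
(`XA.IsDefined`, REAL since ED.2).  NOT typed (p. 38 L56–59): «When `X = Spec k` (resp. `h = 1`, that is, `A` is an elliptic curve, hence is
canonically isomorphic to `A^∨`), the Beilinson–Bloch–Poincaré height pairing for `(X, A)` reduces to the Néron–Tate height pairing (3.2) for `A`
up to `−1` (resp. the Beilinson–Bloch height pairing for `X × A`).»  NO PROOF. [cite: Liu2021, Rem. 3.8 (p. 38)] -/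
def Rem38 : Prop := D.WeightMonodromyX → D.XA.IsDefined

end BBPHeightPairingData

/-- **Data of [Liu2021, Remark 3.9]** (p. 39 L5–11): «The Beilinson–Bloch–Poincaré height pairing can be defined more generally for an abelian
scheme `𝒜` of relative dimension `h ≥ 1` over `X` as a pairing `⟨ , ⟩^{BBP}_𝒜 : CH^{h+i}(𝒜)^0_R × CH^{h+d−i}(𝒜^∨)^0_R → ℂ` such that `⟨z₁, z₂⟩^{BBP}_𝒜 =
⟨z₁, p₁∗(c₁(P).p₂^* z₂)⟩^{BB}_𝒜`, where `p₁ : 𝒜 ×_X 𝒜^∨ → 𝒜` and `p₂ : 𝒜 ×_X 𝒜^∨ → 𝒜^∨` are projection morphisms, and `P` is the relative Poincaré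
bundle on `𝒜 ×_X 𝒜^∨`.»  REAL (ED.2): the abelian scheme `𝒜 → X` is the tree's `AbelianSchemes.AbelianSchemeOver X` of relative dimension `h`
(`IsOfRelDim`), its dual `𝒜^∨` and the relative Poincaré bundle are the tree's `DualPair` (`hat`, `P`), and `CH^n(𝒜^∨)_ℚ = CH_e` of the total
space of `𝒜^∨` (tree `RatChowGroup`, `n + e = d + h`); `Atot` = the §3.2 datum of the total space of `𝒜` (a `k`-scheme through `𝒜 → X → Spec k`,
pure dimension `d + h`).  ⟨CARRIER⟩: `H_{dR}` of `𝒜^∨` with its cycle class map, the transform `z₂ ↦ p₁∗(c₁(P).p₂^* z₂)`.  Nothing asserted.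
[cite: Liu2021, Rem. 3.9 (p. 39)] -/
structure RelBBPData (k : Type) [Field k] [NumberField k] where
  /-- the base `X`, of pure dimension `d` — REAL. -/
  d : ℕ
  /-- `X` — REAL. -/
  X : SchemeOver k
  /-- «relative dimension `h ≥ 1`». -/
  h : ℕ
  /-- «`h ≥ 1`». -/
  one_le_h : 1 ≤ h
  /-- REAL (ED.2): «an abelian scheme `𝒜` … over `X`» (tree `AbelianSchemeOver`). -/
  𝒜 : AbelianSchemeOver X.left
  /-- «of relative dimension `h`» (tree `IsOfRelDim`). -/
  relDim : 𝒜.IsOfRelDim h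
  /-- REAL (ED.2): the dual abelian scheme `𝒜^∨` with «the relative Poincaré bundle on `𝒜 ×_X 𝒜^∨`» (tree `DualPair`). -/
  dual : 𝒜.DualPair
  /-- the §3.2 datum of the total space of `𝒜`. -/
  Atot : BBHeightPairingData k
  /-- `Atot` is the datum OF `𝒜` regarded as a `k`-scheme through `𝒜 → X → Spec k`. -/
  isoA : Atot.X ≅ Over.mk (𝒜.X.hom ≫ X.hom)
  /-- `𝒜` has pure dimension `d + h`. -/
  dA : Atot.d = d + h
  /-- ⟨CARRIER⟩ `H^j_{dR}(𝒜^∨/k)` (as a `ℚ`-space). -/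
  HdRAd : ℕ → ModuleCat.{0} ℚ
  /-- ⟨CARRIER⟩ `cl_{dR}` of `𝒜^∨` on the REAL `CH^n(𝒜^∨)_ℚ = CH_e(𝒜^∨)_ℚ` (total space of `dual.hat`), `n + e = d + h`; its kernels are the
  `CH^n(𝒜^∨)^0_ℚ`. -/
  cldRAd : ∀ ⦃n e : ℕ⦄, n + e = d + h → (RatChowGroup dual.hat.X.left e →ₗ[ℚ] HdRAd (2 * n))
  /-- ⟨CARRIER⟩ `z₂ ↦ p₁∗(c₁(P).p₂^* z₂) : CH^n(𝒜^∨)^0_R → CH^m(𝒜)^0_R`, `n + 1 = m + h` (`P = dual.P`). -/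
  fmRel : ∀ (R : Subalgebra ℚ ℂ) ⦃n e m e' : ℕ⦄ (hn : n + e = d + h) (hm : m + e' = Atot.d), n + 1 = m + h →
    ((R ⊗[ℚ] LinearMap.ker (cldRAd hn)) →ₗ[R] (R ⊗[ℚ] LinearMap.ker (Atot.cldR hm)))

/-- The structure morphism `𝒜 → X` as a morphism of `k`-schemes (the ED.1 carrier field `π`) — REAL (ED.2): `𝒜.X.hom` over `Spec k`.
[cite: Liu2021, Rem. 3.9 (p. 39)] -/
def RelBBPData.toBase {k : Type} [Field k] [NumberField k] (D : RelBBPData k) : Over.mk (D.𝒜.X.hom ≫ D.X.hom) ⟶ D.X :=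
  Over.homMk D.𝒜.X.hom rfl

/-- `CH^n(𝒜^∨)^0_ℚ`: kernel of the carrier `cl_{dR}` on the REAL `CH_e(𝒜^∨)_ℚ`, `n + e = d + h` (ED.2; in ED.1 a bare carrier of this name).
[cite: Liu2021, Rem. 3.9 (p. 39)] -/
abbrev RelBBPData.CH0dualRel {k : Type} [Field k] [NumberField k] (D : RelBBPData k) {n e : ℕ} (hn : n + e = D.d + D.h) :
    Submodule ℚ (RatChowGroup D.dual.hat.X.left e) :=
  LinearMap.ker (D.cldRAd hn)

/-- **[Liu2021, Remark 3.9] — the relative Beilinson–Bloch–Poincaré pairing**: `⟨z₁, z₂⟩^{BBP}_𝒜 := ⟨z₁, p₁∗(c₁(P).p₂^* z₂)⟩^{BB}_𝒜`, for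
`z₁ ∈ CH^{h+i}(𝒜)^0_R`, `z₂ ∈ CH^n(𝒜^∨)^0_R`, `(h + i) + m = (d + h) + 1`, `n + 1 = m + h`. REAL from the carriers. [cite: Liu2021, Rem. 3.9 (p. 39)] -/
def RelBBPData.bbpRel {k : Type} [Field k] [NumberField k] (D : RelBBPData k) (R : Subalgebra ℚ ℂ) ⦃i e₁ m e' n e : ℕ⦄
    (hi : (D.h + i) + e₁ = D.Atot.d) (hm : m + e' = D.Atot.d) (hn : n + e = D.d + D.h) (him : (D.h + i) + m = D.Atot.d + 1)
    (hnm : n + 1 = m + D.h) (z₁ : R ⊗[ℚ] LinearMap.ker (D.Atot.cldR hi)) (z₂ : R ⊗[ℚ] D.CH0dualRel hn) : ℂ :=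
  D.Atot.bbR R hi hm him z₁ (D.fmRel R hn hm hnm z₂)

/-! ## §3.3 Künneth–Chow projectors (p. 39 L19 – p. 40 L21; `k` of characteristic zero) -/

/-- **Data of [Liu2021, §3.3]** (p. 39 L22–48 with §3.1 p. 35 L13–24): «Consider a proper smooth scheme `X ∈ Sch_{/k}` of pure dimension `d`.
Put `H^{even}_{dR}(X/k) := ⊕_{i even} H^i_{dR}(X/k)`, `H^{odd}_{dR}(X/k) := ⊕_{i odd} H^i_{dR}(X/k)`»; «A (Chow self-)correspondence of `X` is an element
`z ∈ CH^d(X × X)`. It induces a graded map `z^* : ⊕ CH^i(X) → ⊕ CH^i(X)` … On the level of various cohomology, it induces graded maps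
`cl^*_{dR}(z) : ⊕ H^i_{dR}(X/k) → ⊕ H^i_{dR}(X/k)` […] When we regard the diagonal `ΔX ⊆ X × X` as a correspondence, we usually write it as
`id_X`»; «for a zero cycle `D` on `X`, we regard its degree `deg D` as a function on `π₀(X)`» (p. 39 L46–48).  REAL: `X`, `smooth`, `proper`;
(ED.2) the calculus of correspondences `C : ChowCorrespondences k` (the tree's hypothesis structure, taken as a datum as the tree prescribes),
`CH^d(X × X)_ℚ = Corr X X d = CH_d(X ×_k X)_ℚ` (tree `Motives.Corr`, as in the squad file `Sec2AlbaneseVariety`), `Δ_X = C.diag d X`, the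
transpose `ᵗz = C.transpose d z`, `CH^i(X)_ℚ = CH_e(X)_ℚ` (`RatChowGroup`, `i + e = d`), `π₀(X)` = Mathlib `ConnectedComponents` of the
underlying space, the correspondences `CH^{3d}((X×X×X)²)_ℚ = Corr (X ⊗ X ⊗ X) (X ⊗ X ⊗ X) (3d)` and Chow groups `CH_e(X ⊗ X ⊗ X)_ℚ` of the triple
product.  ⟨CARRIER⟩ (maps between those real objects): `cl_{dR}`, `H^i_{dR}`, the actions `z^*` («sending `α` to `p₁∗(z.p₂^* α)`», i.e. `(ᵗz)_*`
in the convention of [Fulton1998] Def. 16.1.2 / the tree's `CorrespondenceChowAction`, whose `ℚ`-linear extension is not threaded here) and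
`cl^*_{dR}(z)` (degree-preserving for `z` of codimension `d`; `ℚ`-linear in `z`), componentwise degrees of zero-cycles (the tree's
`Motives.degree` is the total degree), multiplication of Chow classes by locally constant functions, the exterior products `X × D`, `D × X`
(`p₂^* D`, `p₁^* D`; the tree's `ChowGroup.flatPullback` along the projections, whose flatness / relative-dimension bookkeeping is not threaded
here), Def. 2.8 «almost ample» and the correspondence `e_{X,D}` of Prop. 2.12 (§2; typed for divisors in the squad file
`Sec2AlbaneseVariety.lean`, carried here on classes, not restated), the triple exterior product of correspondences (not in the tree:
`ChowCorrespondences`, «Not here»), and `cl_{dR}`, `w^*`, `cl^*_{dR}(w)` for `X × X × X`.  ⟨CARRIER LAW⟩ `clStar_delta`: `cl^*_{dR}(id_X) = id`.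
Nothing asserted. [cite: Liu2021, §3.3 (p. 39) and §3.1 (p. 35)] -/
structure KunnethChowData (k : Type) [Field k] [CharZero k] where
  /-- «of pure dimension `d`». -/
  d : ℕ
  /-- «a proper smooth scheme `X ∈ Sch_{/k}`» — REAL. -/
  X : SchemeOver k
  /-- smooth of pure dimension `d`. -/
  smooth : _root_.AlgebraicGeometry.SmoothOfRelativeDimension d X.hom
  /-- proper. -/
  proper : _root_.AlgebraicGeometry.IsProper X.hom
  /-- REAL (ED.2): the calculus of Chow correspondences over `k` (composition, transpose, graphs, diagonal; tree hypothesis structure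
  `ChowCorrespondences`, [Fulton1998] §16.1). -/
  C : ChowCorrespondences k
  /-- ⟨CARRIER⟩ `H^i_{dR}(X/k)` (as a `ℚ`-space, READING V1). -/
  HdR : ℕ → ModuleCat.{0} ℚ
  /-- ⟨CARRIER⟩ `cl_{dR} : CH^i(X)_ℚ → H^{2i}_{dR}(X/k)` on the REAL `CH_e(X)_ℚ`, `i + e = d`. -/
  cldR : ∀ ⦃i e : ℕ⦄, i + e = d → (RatChowGroup X.left e →ₗ[ℚ] HdR (2 * i))
  /-- ⟨CARRIER⟩ `z ↦ z^*`, the degree-preserving action of correspondences `z ∈ CH^d(X × X)_ℚ` (REAL `Corr X X d`) on `⊕_e CH_e(X)_ℚ` («sending `α` to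
  `p₁∗(z.p₂^* α)`»), `ℚ`-linear in `z`. -/
  corrAct : Corr X X d →ₗ[ℚ] ((e : ℕ) → Module.End ℚ (RatChowGroup X.left e))
  /-- ⟨CARRIER⟩ `z ↦ cl^*_{dR}(z)`, the degree-preserving action on `⊕_i H^i_{dR}(X/k)`. -/
  clStar : Corr X X d →ₗ[ℚ] ((i : ℕ) → Module.End ℚ (HdR i))
  /-- ⟨CARRIER LAW⟩ `cl^*_{dR}(Δ_X)` is the identity («we usually write it as `id_X`»), `Δ_X` the REAL diagonal `C.diag d X`. -/
  clStar_delta : clStar (C.diag d X) = 1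
  /-- ⟨CARRIER⟩ the degree of a zero-cycle class (`CH^d(X)_ℚ = CH_0(X)_ℚ`, REAL) on each connected component (p. 39 L46–48; `π₀(X)` REAL, Mathlib
  `ConnectedComponents`). -/
  deg : RatChowGroup X.left 0 → ConnectedComponents ↥X.left → ℚ
  /-- ⟨CARRIER⟩ multiplication of Chow classes by a locally constant function `π₀(X) → ℚ` (`CH(X) = ⊕_c CH(X_c)`). -/
  lcMul : (ConnectedComponents ↥X.left → ℚ) → ∀ e : ℕ, Module.End ℚ (RatChowGroup X.left e)
  /-- ⟨CARRIER⟩ `D ↦ X × D` (`= p₂^* D`), a zero-cycle class to a correspondence (Lem. 3.11 (1)). -/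
  boxRight : RatChowGroup X.left 0 →ₗ[ℚ] Corr X X d
  /-- ⟨CARRIER⟩ `D ↦ D × X` (`= p₁^* D`). -/
  boxLeft : RatChowGroup X.left 0 →ₗ[ℚ] Corr X X d
  /-- ⟨CARRIER⟩ «almost ample divisor (Definition 2.8)», a predicate on `CH¹(X)_ℚ = CH_{e₁}(X)_ℚ`, `1 + e₁ = d` — [Liu2021] Def. 2.8, typed for divisors in
  `Sec2AlbaneseVariety.lean`. -/
  IsAlmostAmple : ∀ ⦃e₁ : ℕ⦄, 1 + e₁ = d → RatChowGroup X.left e₁ → Prop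
  /-- ⟨CARRIER⟩ «the correspondence `e_{X,D}` in Proposition 2.12» for `D ∈ CH¹(X)_ℚ` (meaningful for `d = 2`) — [Liu2021] Prop. 2.12, typed in
  `Sec2AlbaneseVariety.lean` (`picardCorrespondence`, valued in the same REAL `Corr X X d`). -/
  eCorr : ∀ ⦃e₁ : ℕ⦄, 1 + e₁ = d → RatChowGroup X.left e₁ → Corr X X d
  /-- ⟨CARRIER⟩ the triple exterior product `(z₁, z₂, z₃) ↦ z₁ × z₂ × z₃` of correspondences (Lem. 3.12 (2)), valued in the REAL correspondences of
  `X × X × X` (dimension `3d`). -/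
  box3 : Corr X X d → Corr X X d → Corr X X d → Corr (X ⊗ X ⊗ X) (X ⊗ X ⊗ X) (3 * d)
  /-- ⟨CARRIER⟩ `H^i_{dR}((X × X × X)/k)`. -/
  HdR3 : ℕ → ModuleCat.{0} ℚ
  /-- ⟨CARRIER⟩ `cl_{dR}` of `X × X × X` on the REAL `CH_e(X ⊗ X ⊗ X)_ℚ`, `i + e = 3d`. -/
  cldR3 : ∀ ⦃i e : ℕ⦄, i + e = 3 * d → (RatChowGroup (X ⊗ X ⊗ X).left e →ₗ[ℚ] HdR3 (2 * i))
  /-- ⟨CARRIER⟩ `w ↦ w^*` on `⊕_e CH_e(X × X × X)_ℚ`. -/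
  corrAct3 : Corr (X ⊗ X ⊗ X) (X ⊗ X ⊗ X) (3 * d) →ₗ[ℚ] ((e : ℕ) → Module.End ℚ (RatChowGroup (X ⊗ X ⊗ X).left e))
  /-- ⟨CARRIER⟩ `w ↦ cl^*_{dR}(w)` on `⊕_i H^i_{dR}((X × X × X)/k)`. -/
  clStar3 : Corr (X ⊗ X ⊗ X) (X ⊗ X ⊗ X) (3 * d) →ₗ[ℚ] ((i : ℕ) → Module.End ℚ (HdR3 i))

namespace KunnethChowData

variable {k : Type} [Field k] [CharZero k] (D : KunnethChowData k)

/-- `CH^d(X × X)_ℚ`, «the (Chow self-)correspondences of `X`» with `ℚ`-coefficients — REAL (ED.2): the tree's `Corr X X d = CH_d(X ×_k X)_ℚ`.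
[cite: Liu2021, §3.1 (p. 35) and §3.3 (p. 39)] -/
abbrev Corr : Type := Literature.AlgebraicGeometry.Motives.Corr D.X D.X D.d

/-- `Δ_X = id_X`, the diagonal as a correspondence — REAL (ED.2): `C.diag d X` ([Fulton1998] Cor. 16.1.1). [cite: Liu2021, §3.1 (p. 35)] -/
def delta : D.Corr := D.C.diag D.d D.X

/-- `CH^i(X)_ℚ = CH_e(X)_ℚ`, `i + e = d` — REAL (tree `RatChowGroup`). [cite: Liu2021, §3.1 (p. 34)] -/
abbrev CHQ (e : ℕ) : Type := RatChowGroup D.X.left e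

/-- `π₀(X)`, the set of connected components (p. 39 L46) — REAL (ED.2; the ED.1 carrier field `π₀`, renamed ASCII for the tooling): Mathlib
`ConnectedComponents` of the underlying space. [cite: Liu2021, §3.3 (p. 39)] -/
abbrev pi0 : Type := ConnectedComponents ↥D.X.left

/-- The transpose `z ↦ ᵗz` of a correspondence (Lem. 3.11 (2): «`ᵗe_{X,D}` is its transpose») — REAL (ED.2): `C.transpose d` ([Fulton1998] Def.
16.1.1). [cite: Liu2021, Lem. 3.11 (2) (p. 39)] -/
def transpose (z : D.Corr) : D.Corr := D.C.transpose D.d z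

/-- `CH^{3d}((X × X × X) × (X × X × X))_ℚ`, the correspondences of `X × X × X` — REAL (ED.2). [cite: Liu2021, Lem. 3.12 (2) (p. 40)] -/
abbrev Corr3 : Type := Literature.AlgebraicGeometry.Motives.Corr (D.X ⊗ D.X ⊗ D.X) (D.X ⊗ D.X ⊗ D.X) (3 * D.d)

/-- `CH^i(X × X × X)_ℚ = CH_e(X ⊗ X ⊗ X)_ℚ`, `i + e = 3d` — REAL (ED.2). [cite: Liu2021, Def. 3.13 (p. 40)] -/
abbrev CHQ3 (e : ℕ) : Type := RatChowGroup (D.X ⊗ D.X ⊗ D.X).left e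

/-- **[Liu2021, Definition 3.10], even, AS PRINTED** (p. 39 L41–44): «We say that a correspondence `z ∈ CH^d(X × X)_ℚ` is an *even* (resp. *odd*)
*projector* if the map `cl^*_{dR}(z)` is the projection map to `H^{even}_{dR}(X/k)` (resp. `H^{odd}_{dR}(X/k)`).»  On the graded pieces: `cl^*_{dR}(z)`
is the identity on `H^i_{dR}` for `i` even and zero for `i` odd. [cite: Liu2021, Def. 3.10 (p. 39)] -/
def IsEvenProjector (z : D.Corr) : Prop := ∀ i : ℕ, D.clStar z i = if Even i then 1 else 0

/-- **[Liu2021, Definition 3.10], odd**: `cl^*_{dR}(z)` is the projection to `H^{odd}_{dR}(X/k)` — the identity on `H^i_{dR}` for `i` odd, zero for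
`i` even. [cite: Liu2021, Def. 3.10 (p. 39)] -/
def IsOddProjector (z : D.Corr) : Prop := ∀ i : ℕ, D.clStar z i = if Odd i then 1 else 0

/-- Definition 3.10 under one name (squad token): a Künneth–Chow projector of parity `odd = false` (even) or `odd = true` (odd).
[cite: Liu2021, Def. 3.10 (p. 39)] -/
def IsKunnethChowProjector (odd : Bool) (z : D.Corr) : Prop :=
  if odd then D.IsOddProjector z else D.IsEvenProjector z

/-- The same notion for `X × X × X` (Lem. 3.12 (2): «is an odd projector for `X × X × X`»). [cite: Liu2021, Def. 3.10 and Lem. 3.12 (2) (pp. 39–40)] -/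
def IsOddProjector3 (w : D.Corr3) : Prop := ∀ i : ℕ, D.clStar3 w i = if Odd i then 1 else 0

/-- **The cycle `z_{X,D}` of [Liu2021, Lemma 3.11 (1)]** (p. 39 L50–54, `d = 1`): «`z_{X,D} := ΔX − (1/deg D)(X × D + D × X)`», with `1/deg D` the
locally constant function `c ↦ (deg D|_c)⁻¹` on `π₀(X)` (p. 39 L46–48) multiplying the zero-cycle `D` (Mathlib `⁻¹`, junk `0⁻¹ = 0` off the
hypothesis of the lemma).  REAL from the carriers on the REAL `Δ_X`, `CH_0(X)_ℚ`; stated for zero-cycle classes `D ∈ CH^d(X)_ℚ = CH_0(X)_ℚ` (`d = 1`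
in the lemma). [cite: Liu2021, Lem. 3.11 (1) (p. 39)] -/
def zCurve (Dv : D.CHQ 0) : D.Corr :=
  D.delta - (D.boxRight (D.lcMul (fun c => (D.deg Dv c)⁻¹) 0 Dv) + D.boxLeft (D.lcMul (fun c => (D.deg Dv c)⁻¹) 0 Dv))

/-- **[Liu2021, Lemma 3.11 (1)] AS PRINTED** (p. 39 L49–54): «Suppose that `d = 1`. Let `D ∈ CH¹(X)_ℚ` be a cycle such that `deg D` is nonzero on every
connected component of `X`. Then `z_{X,D} := ΔX − (1/deg D)(X × D + D × X)` is an odd projector for `X`.» (`CH¹(X) = CH_0(X)` for `d = 1`.)  NO PROOF.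
[cite: Liu2021, Lem. 3.11 (1) (p. 39)] -/
def Lem311_1 : Prop :=
  D.d = 1 → ∀ Dv : D.CHQ 0, (∀ c : D.pi0, D.deg Dv c ≠ 0) → D.IsOddProjector (D.zCurve Dv)

/-- **The cycle `z_{X,D} := e_{X,D} + ᵗe_{X,D}` of [Liu2021, Lemma 3.11 (2)]** (p. 39 L55–58, `d = 2`), for `D ∈ CH¹(X)_ℚ = CH_{e₁}(X)_ℚ`, `1 + e₁ = d`.
REAL from the carrier `e_{X,D}` (Prop. 2.12) and the REAL transpose. [cite: Liu2021, Lem. 3.11 (2) (p. 39)] -/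
def zSurface ⦃e₁ : ℕ⦄ (h1 : 1 + e₁ = D.d) (Dv : D.CHQ e₁) : D.Corr := D.eCorr h1 Dv + D.transpose (D.eCorr h1 Dv)

/-- **[Liu2021, Lemma 3.11 (2)] AS PRINTED** (p. 39 L55–58): «Suppose that `d = 2`. Let `D ∈ CH¹(X)_ℚ` be a cycle that is an almost ample divisor
(Definition 2.8). Then `z_{X,D} := e_{X,D} + ᵗe_{X,D}` is an odd projector for `X`, where `e_{X,D}` is the correspondence in Proposition 2.12 and
`ᵗe_{X,D}` is its transpose.»  NO PROOF. [cite: Liu2021, Lem. 3.11 (2) (p. 39)] -/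
def Lem311_2 : Prop :=
  D.d = 2 → ∀ ⦃e₁ : ℕ⦄ (h1 : 1 + e₁ = D.d) (Dv : D.CHQ e₁), D.IsAlmostAmple h1 Dv → D.IsOddProjector (D.zSurface h1 Dv)

/-- **[Liu2021, Lemma 3.12 (1)] AS PRINTED** (p. 40 L6–9): «Let `z` be an odd projector for `X`. Then (1) the image of the induced map
`z^* : CH^i(X)_ℚ → CH^i(X)_ℚ` is contained in `CH^i(X)^0_ℚ`» (`= ker cl_{dR}`; every codimension `i`, carried as `i + e = d`).  NO PROOF.
[cite: Liu2021, Lem. 3.12 (1) (p. 40)] -/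
def Lem312_1 : Prop :=
  ∀ z : D.Corr, D.IsOddProjector z → ∀ ⦃i e : ℕ⦄ (h : i + e = D.d) (x : D.CHQ e), D.corrAct z e x ∈ LinearMap.ker (D.cldR h)

/-- **The cycle of [Liu2021, Lemma 3.12 (2)]** (p. 40 L10–12): «`z × z × z + z × (ΔX − z) × (ΔX − z) + (ΔX − z) × z × (ΔX − z) + (ΔX − z) × (ΔX − z) × z`»,
a correspondence of `X × X × X`. REAL from the carrier `box3` on the REAL `Corr X X d`, `Δ_X`. [cite: Liu2021, Lem. 3.12 (2) (p. 40)] -/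
def oddTriple (z : D.Corr) : D.Corr3 :=
  D.box3 z z z + D.box3 z (D.delta - z) (D.delta - z) + D.box3 (D.delta - z) z (D.delta - z) +
    D.box3 (D.delta - z) (D.delta - z) z

/-- **[Liu2021, Lemma 3.12 (2)] AS PRINTED** (p. 40 L6, L10–13): «Let `z` be an odd projector for `X`. Then […] (2) the cycle `z × z × z + z × (ΔX − z)
× (ΔX − z) + (ΔX − z) × z × (ΔX − z) + (ΔX − z) × (ΔX − z) × z` is an odd projector for `X × X × X`.»  NO PROOF. [cite: Liu2021, Lem. 3.12 (2) (p. 40)] -/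
def Lem312_2 : Prop :=
  ∀ z : D.Corr, D.IsOddProjector z → D.IsOddProjector3 (D.oddTriple z)

/-- **[Liu2021, Definition 3.13] — `pr^{[3]}_z`** (p. 40 L18–21): «Let `z` be an odd projector for `X`. We define `pr^{[3]}_z : CH^i(X × X × X)_ℚ →
CH^i(X × X × X)^0_ℚ` to be the map induced by the odd projector for `X × X × X` as in Lemma 3.12(2).»  REAL as the action of `oddTriple z` on the REAL
`CH_e(X × X × X)_ℚ`; that it lands in `CH^i(X × X × X)^0_ℚ` (the printed codomain; Lem. 3.12 (1) for `X × X × X`) is `Def313Range`.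
[cite: Liu2021, Def. 3.13 (p. 40)] -/
def pr3 (z : D.Corr) (e : ℕ) : Module.End ℚ (D.CHQ3 e) := D.corrAct3 (D.oddTriple z) e

/-- **[Liu2021, Definition 3.13], the printed codomain**: for an odd projector `z`, `pr^{[3]}_z` takes values in `CH^i(X × X × X)^0_ℚ = ker cl_{dR}`
(`i + e = 3d`).  Predicate; NO PROOF. [cite: Liu2021, Def. 3.13 with Lem. 3.12 (p. 40)] -/
def Def313Range : Prop :=
  ∀ z : D.Corr, D.IsOddProjector z → ∀ ⦃i e : ℕ⦄ (h : i + e = 3 * D.d) (x : D.CHQ3 e), D.pr3 z e x ∈ LinearMap.ker (D.cldR3 h)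

end KunnethChowData

end Literature.NumberTheory.Automorphic.Liu2021.Sec3CyclesHeightPairings

end
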